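import Mathlib.Analysis.Normed.Algebra.Exponential
import Mathlib.Analysis.SpecialFunctions.Exponential
import Mathlib.Analysis.Normed.Operator.ContinuousLinearMap
import Mathlib.Analysis.Normed.Module.Basic
import Mathlib.LinearAlgebra.Span.Basic
import Mathlib.Data.Nat.Choose.Sum
import Mathlib.Algebra.BigOperators.Fin
import Mathlib.Order.Iterate
import Mathlib.Analysis.Normed.Operator.Bilinear
import Mathlib.Topology.Algebra.InfiniteSum.Module

/-!
# Crux `LatticeGapInUVUnits`, line `knabe-block-sampler`: stub S6 `stub_lightCone`

Support file for item stmt-QuantumFields-9366 (route `LangevinControlUV` of `YangMills`), registered stub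
`stub_lightCone` = `LightCone`: finite speed of propagation for block-resampling semigroups
`exp(-t ∑_{z∈Λ} (1 - T z))` generated by contractions `T z` on a real Banach space that act as the identity on vectors
located away from `z` (hypotheses (A1)–(A3)); Dyson/word expansion `e^{-t#Λ} ∑ₖ tᵏ/k! (∑_{z∈Λ} T z)ᵏ`, exact deletion of
letters not adjacent to the causal region, outside letters replaced by `1`, counting of increasing adjacency chains.
The file introduces no new vocabulary: the proof is a recursion on the Taylor order at the vector level, the
state being a finset of pairs (located site, depth budget).
-/

open scoped BigOperators
open Filter Topology

noncomputable section

namespace Summit.QuantumFields.YangMills.Theorems.LatticeGapInUVUnits.KnabeBlockSampler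

/-- Powers of an operator of norm at most `c` are bounded by `c ^ k` pointwise. -/
private theorem lightCone_norm_pow_apply {E : Type*} [NormedAddCommGroup E] [NormedSpace ℝ E]
    (A : E →L[ℝ] E) (c : ℝ) (hA : ‖A‖ ≤ c) (k : ℕ) (x : E) : ‖(A ^ k) x‖ ≤ c ^ k * ‖x‖ := by
  induction k generalizing x with
  | zero => simp
  | succ k ih =>
    have hc : 0 ≤ c := (norm_nonneg _).trans hA
    rw [pow_succ, mul_apply_eq_comp]
    calc ‖(A ^ k) (A x)‖ ≤ c ^ k * ‖A x‖ := ih _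
      _ ≤ c ^ k * (c * ‖x‖) := mul_le_mul_of_nonneg_left (A.le_of_opNorm_le hA x) (pow_nonneg hc k)
      _ = c ^ (k + 1) * ‖x‖ := by ring

/-- A sum of contractions indexed by a finite type has norm at most the cardinality. -/
private theorem lightCone_norm_sum_le {E : Type*} [NormedAddCommGroup E] [NormedSpace ℝ E]
    {ι : Type*} [Fintype ι] (S : ι → E →L[ℝ] E) (hS : ∀ z, ‖S z‖ ≤ 1) :
    ‖∑ z, S z‖ ≤ Fintype.card ι := by
  calc ‖∑ z, S z‖ ≤ ∑ z, ‖S z‖ := norm_sum_le _ _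
    _ ≤ ∑ _z : ι, (1 : ℝ) := Finset.sum_le_sum fun z _ => hS z
    _ = Fintype.card ι := by simp

/-- Normalisation of the semigroup: `exp (-(t ∑ (1 - S z))) = e^{-t n} • exp (t ∑ S z)`. -/
private theorem lightCone_exp_shift {𝔸 : Type*} [NormedRing 𝔸] [NormedAlgebra ℝ 𝔸] [CompleteSpace 𝔸]
    {ι : Type*} [Fintype ι] (S : ι → 𝔸) (t : ℝ) :
    NormedSpace.exp (-(t • ∑ z, (1 - S z))) =
      Real.exp (-(t * Fintype.card ι)) • NormedSpace.exp (t • ∑ z, S z) := by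
  letI : NormedAlgebra ℚ 𝔸 := NormedAlgebra.restrictScalars ℚ ℝ 𝔸
  have h1 : -(t • ∑ z, (1 - S z)) = t • ∑ z, S z + algebraMap ℝ 𝔸 (-(t * Fintype.card ι)) := by
    rw [Algebra.algebraMap_eq_smul_one, Finset.sum_sub_distrib, Finset.sum_const, Finset.card_univ,
      ← Nat.cast_smul_eq_nsmul ℝ, smul_sub, smul_smul, neg_smul]
    abel
  rw [h1, NormedSpace.exp_add_of_commute (Algebra.commute_algebraMap_right _ _),
    ← NormedSpace.algebraMap_exp_comm, ← congrFun Real.exp_eq_exp_ℝ, ← Algebra.commutes,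
    Algebra.algebraMap_eq_smul_one, smul_mul_assoc, one_mul]

/-- The scalar resummation `∑ₖ tᵏ/k! · X · C(k, m) · c^{k-m} = X tᵐ/m! · e^{tc}`. -/
private theorem lightCone_hasSum_tail (t c X : ℝ) (m : ℕ) :
    HasSum (fun k : ℕ => (k.factorial : ℝ)⁻¹ * t ^ k * (X * (k.choose m : ℝ) * c ^ (k - m)))
      (X * t ^ m / m.factorial * Real.exp (t * c)) := by
  set F : ℕ → ℝ := fun k => (k.factorial : ℝ)⁻¹ * t ^ k * (X * (k.choose m : ℝ) * c ^ (k - m))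
    with hF
  have hexp : HasSum (fun j : ℕ => (t * c) ^ j / j.factorial) (Real.exp (t * c)) := by
    rw [Real.exp_eq_exp_ℝ]
    exact NormedSpace.expSeries_div_hasSum_exp (t * c)
  have heq : (fun j : ℕ => F (j + m)) =
      fun j => X * t ^ m / m.factorial * ((t * c) ^ j / j.factorial) := by
    funext j
    have hj : (j.factorial : ℝ) ≠ 0 := Nat.cast_ne_zero.mpr (Nat.factorial_ne_zero j)
    have hm : (m.factorial : ℝ) ≠ 0 := Nat.cast_ne_zero.mpr (Nat.factorial_ne_zero m)
    have hjm : ((j + m).factorial : ℝ) ≠ 0 := Nat.cast_ne_zero.mpr (Nat.factorial_ne_zero _)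
    have hC : ((j + m).choose m : ℝ) = (j + m).factorial / (j.factorial * m.factorial) := by
      rw [eq_div_iff (mul_ne_zero hj hm), ← mul_assoc]
      exact_mod_cast Nat.add_choose_mul_factorial_mul_factorial j m
    simp only [hF, Nat.add_sub_cancel, pow_add, mul_pow, hC]
    field_simp
  have h2 : HasSum (fun j : ℕ => F (j + m)) (X * t ^ m / m.factorial * Real.exp (t * c)) := by
    rw [heq]
    exact hexp.mul_left _
  have h3 := h2.sum_range_add
  have h0 : ∑ i ∈ Finset.range m, F i = 0 := by
    refine Finset.sum_eq_zero fun i hi => ?_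
    simp only [hF, Nat.choose_eq_zero_of_lt (Finset.mem_range.mp hi), Nat.cast_zero, mul_zero,
      zero_mul]
  rwa [h0, zero_add] at h3

/-- Pascal's rule in the weighted form used by the counting recursion. -/
private theorem lightCone_pascal (n K : ℝ) (k b : ℕ) :
    n * (K ^ (b + 1) * ((k.choose (b + 1) : ℕ) : ℝ) * n ^ (k - (b + 1))) +
        K * (K ^ b * ((k.choose b : ℕ) : ℝ) * n ^ (k - b)) =
      K ^ (b + 1) * (((k + 1).choose (b + 1) : ℕ) : ℝ) * n ^ (k + 1 - (b + 1)) := by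
  rw [Nat.choose_succ_succ', Nat.add_sub_add_right, Nat.cast_add]
  rcases lt_or_ge k (b + 1) with h | h
  · rw [Nat.choose_eq_zero_of_lt h]
    simp only [Nat.cast_zero, mul_zero, zero_mul, add_zero, zero_add]
    ring
  · obtain ⟨m, rfl⟩ : ∃ m, k = b + 1 + m := ⟨k - (b + 1), by omega⟩
    rw [show b + 1 + m - (b + 1) = m by omega, show b + 1 + m - b = m + 1 by omega]
    ring

/-- Main recursion (abstract Dyson/word bookkeeping at the vector level): for a state `S` of pairs
`(y, β)` (located site, depth budget) and `x` located in the sites of `S`, the order-`k` Taylor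
coefficients of the two semigroups differ by at most `2‖x‖ ∑_{(y,β) ∈ S} G β k`. -/
private theorem lightCone_main {E : Type*} [NormedAddCommGroup E] [NormedSpace ℝ E]
    {ι : Type*} [Fintype ι] [DecidableEq ι] (adj : ι → ι → Prop) [DecidableRel adj] (K n : ℝ)
    (T T' : ι → E →L[ℝ] E) (M : Finset ι → Submodule ℝ E) (N : Finset ι → Finset ι)
    (Λ : Finset ι) (G : ℕ → ℕ → ℝ)
    (hcol : ∀ (w : ι) (g : ℝ), 0 ≤ g → ∑ z, (if adj z w then g else 0) ≤ K * g)
    (hn : (Fintype.card ι : ℝ) = n)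
    (hAn : ‖∑ z, T z‖ ≤ n) (hA'n : ‖∑ z, T' z‖ ≤ n) (hT : ∀ z, ‖T z‖ ≤ 1)
    (hT'in : ∀ z ∈ Λ, T' z = T z) (hT'out : ∀ z ∉ Λ, ∀ x, T' z x = x)
    (hA2 : ∀ (z : ι) (R : Finset ι), ∀ x ∈ M R, T z x ∈ M (insert z R))
    (hA3 : ∀ (z : ι) (R : Finset ι), (∀ w ∈ R, ¬ adj z w) → ∀ x ∈ M R, T z x = x)
    (hNmono : Monotone N) (hNadj : ∀ (R : Finset ι) (z w : ι), w ∈ R → adj z w → z ∈ N R)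
    (hG0 : ∀ β k, 0 ≤ G β k) (hG1 : ∀ k, G 0 k = n ^ k)
    (hG2 : ∀ b k, n * G (b + 1) k + K * G b k = G (b + 1) (k + 1))
    (k : ℕ) (S : Finset (ι × ℕ)) (hS : ∀ p ∈ S, ∀ j < p.2, N^[j] {p.1} ⊆ Λ)
    (x : E) (hx : x ∈ M (S.image Prod.fst)) :
    ‖((∑ z, T z) ^ k) x - ((∑ z, T' z) ^ k) x‖ ≤ 2 * ‖x‖ * ∑ p ∈ S, G p.2 k := by
  induction k generalizing S x with
  | zero =>
    simp only [pow_zero, one_apply_eq_self, sub_self, norm_zero]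
    exact mul_nonneg (mul_nonneg two_pos.le (norm_nonneg _))
      (Finset.sum_nonneg fun p _ => hG0 _ _)
  | succ k ih =>
    set A : E →L[ℝ] E := ∑ z, T z with hA
    set A' : E →L[ℝ] E := ∑ z, T' z with hA'
    have hn0 : 0 ≤ n := (norm_nonneg _).trans hAn
    by_cases h0 : ∃ p ∈ S, p.2 = 0
    · obtain ⟨p, hp, hp0⟩ := h0
      have h1 : ‖(A ^ (k + 1)) x‖ ≤ n ^ (k + 1) * ‖x‖ := lightCone_norm_pow_apply A n hAn (k + 1) x
      have h2 : ‖(A' ^ (k + 1)) x‖ ≤ n ^ (k + 1) * ‖x‖ :=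
        lightCone_norm_pow_apply A' n hA'n (k + 1) x
      have h3 : n ^ (k + 1) ≤ ∑ q ∈ S, G q.2 (k + 1) := by
        calc n ^ (k + 1) = G p.2 (k + 1) := by rw [hp0, hG1]
          _ ≤ ∑ q ∈ S, G q.2 (k + 1) :=
            Finset.single_le_sum (f := fun q => G q.2 (k + 1)) (fun q _ => hG0 q.2 (k + 1)) hp
      calc ‖(A ^ (k + 1)) x - (A' ^ (k + 1)) x‖ ≤ ‖(A ^ (k + 1)) x‖ + ‖(A' ^ (k + 1)) x‖ :=
            norm_sub_le _ _
        _ ≤ n ^ (k + 1) * ‖x‖ + n ^ (k + 1) * ‖x‖ := add_le_add h1 h2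
        _ = 2 * ‖x‖ * n ^ (k + 1) := by ring
        _ ≤ 2 * ‖x‖ * ∑ q ∈ S, G q.2 (k + 1) := by gcongr
    · push Not at h0
      set R : Finset ι := S.image Prod.fst with hR
      set σ : ℝ := ∑ q ∈ S, G q.2 k with hσ
      set τ : ι → ℝ := fun z => ∑ q ∈ S, if adj z q.1 then G (q.2 - 1) k else 0 with hτ
      have hτ0 : ∀ z, 0 ≤ τ z := fun z =>
        Finset.sum_nonneg fun q _ => by split_ifs <;> [exact hG0 _ _; exact le_rfl]
      have hσ0 : 0 ≤ σ := Finset.sum_nonneg fun q _ => hG0 _ _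
      have claim : ∀ z, ‖(A ^ k) (T z x) - (A' ^ k) (T' z x)‖ ≤ 2 * ‖x‖ * (σ + τ z) := by
        intro z
        by_cases hz : ∃ w ∈ R, adj z w
        · obtain ⟨w, hw, hzw⟩ := hz
          obtain ⟨p, hp, rfl⟩ := Finset.mem_image.mp hw
          have hp1 : 1 ≤ p.2 := Nat.one_le_iff_ne_zero.mpr (h0 p hp)
          have hzN : z ∈ N {p.1} := hNadj {p.1} z p.1 (Finset.mem_singleton_self _) hzw
          have hGτ : G (p.2 - 1) k ≤ τ z := by
            calc G (p.2 - 1) k = (if adj z p.1 then G (p.2 - 1) k else 0) := by rw [if_pos hzw]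
              _ ≤ τ z :=
                Finset.single_le_sum (f := fun q => if adj z q.1 then G (q.2 - 1) k else 0)
                  (fun q _ => by split_ifs <;> [exact hG0 _ _; exact le_rfl]) hp
          have hTx : ‖T z x‖ ≤ ‖x‖ := ((T z).le_of_opNorm_le (hT z) x).trans (by rw [one_mul])
          by_cases hzΛ : z ∈ Λ
          · rw [hT'in z hzΛ]
            have hx' : T z x ∈ M ((insert (z, p.2 - 1) S).image Prod.fst) := by
              rw [Finset.image_insert]
              exact hA2 z R x hx
            have hS' : ∀ q ∈ insert (z, p.2 - 1) S, ∀ j < q.2, N^[j] {q.1} ⊆ Λ := by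
              intro q hq j hj
              rcases Finset.mem_insert.mp hq with rfl | hq
              · have h1 : ({z} : Finset ι) ⊆ N {p.1} := Finset.singleton_subset_iff.mpr hzN
                dsimp only at hj ⊢
                calc N^[j] {z} ⊆ N^[j] (N {p.1}) := hNmono.iterate j h1
                  _ = N^[j + 1] {p.1} := (Function.iterate_succ_apply N j {p.1}).symm
                  _ ⊆ Λ := hS p hp (j + 1) (by omega)
              · exact hS q hq j hj
            have key := ih (insert (z, p.2 - 1) S) hS' (T z x) hx'
            have hins : ∑ q ∈ insert (z, p.2 - 1) S, G q.2 k ≤ G (p.2 - 1) k + σ := by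
              by_cases hmem : (z, p.2 - 1) ∈ S
              · rw [Finset.insert_eq_of_mem hmem]
                linarith [hG0 (p.2 - 1) k]
              · rw [Finset.sum_insert hmem]
            calc ‖(A ^ k) (T z x) - (A' ^ k) (T z x)‖
                ≤ 2 * ‖T z x‖ * ∑ q ∈ insert (z, p.2 - 1) S, G q.2 k := key
              _ ≤ 2 * ‖x‖ * (G (p.2 - 1) k + σ) :=
                mul_le_mul (by linarith) hins (Finset.sum_nonneg fun q _ => hG0 _ _)
                  (mul_nonneg two_pos.le (norm_nonneg _))
              _ ≤ 2 * ‖x‖ * (σ + τ z) :=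
                mul_le_mul_of_nonneg_left (by linarith) (mul_nonneg two_pos.le (norm_nonneg _))
          · rw [hT'out z hzΛ x]
            have hp2 : p.2 = 1 := by
              by_contra hne
              exact hzΛ (hS p hp 1 (lt_of_le_of_ne hp1 (Ne.symm hne)) (by simpa using hzN))
            have h1 : ‖(A ^ k) (T z x)‖ ≤ n ^ k * ‖x‖ :=
              (lightCone_norm_pow_apply A n hAn k _).trans
                (mul_le_mul_of_nonneg_left hTx (pow_nonneg hn0 k))
            have h2 : ‖(A' ^ k) x‖ ≤ n ^ k * ‖x‖ := lightCone_norm_pow_apply A' n hA'n k x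
            have h3 : n ^ k ≤ τ z := by
              rw [← hG1 k]
              simpa [hp2] using hGτ
            calc ‖(A ^ k) (T z x) - (A' ^ k) x‖ ≤ n ^ k * ‖x‖ + n ^ k * ‖x‖ :=
                norm_sub_le_of_le h1 h2
              _ = 2 * ‖x‖ * n ^ k := by ring
              _ ≤ 2 * ‖x‖ * (σ + τ z) := by
                gcongr
                linarith
        · push Not at hz
          have h1 : T z x = x := hA3 z R hz x hx
          have h2 : T' z x = x := by
            by_cases hzΛ : z ∈ Λ
            · rw [hT'in z hzΛ, h1]
            · exact hT'out z hzΛ x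
          rw [h1, h2]
          calc ‖(A ^ k) x - (A' ^ k) x‖ ≤ 2 * ‖x‖ * σ := ih S hS x hx
            _ ≤ 2 * ‖x‖ * (σ + τ z) := by
              gcongr
              linarith [hτ0 z]
      have hAx : A x = ∑ z, T z x := by rw [hA, sum_apply]
      have hA'x : A' x = ∑ z, T' z x := by rw [hA', sum_apply]
      have hexp : (A ^ (k + 1)) x - (A' ^ (k + 1)) x =
          ∑ z, ((A ^ k) (T z x) - (A' ^ k) (T' z x)) := by
        rw [pow_succ, pow_succ, mul_apply_eq_comp, mul_apply_eq_comp, hAx, hA'x, map_sum, map_sum,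
          Finset.sum_sub_distrib]
      have hcount : n * σ + ∑ z, τ z ≤ ∑ q ∈ S, G q.2 (k + 1) := by
        have e1 : ∑ z, τ z ≤ ∑ q ∈ S, K * G (q.2 - 1) k := by
          simp only [hτ]
          rw [Finset.sum_comm]
          exact Finset.sum_le_sum fun q _ => hcol q.1 _ (hG0 _ _)
        calc n * σ + ∑ z, τ z ≤ n * σ + ∑ q ∈ S, K * G (q.2 - 1) k := by linarith
          _ = ∑ q ∈ S, (n * G q.2 k + K * G (q.2 - 1) k) := by
            rw [Finset.sum_add_distrib, Finset.mul_sum]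
          _ = ∑ q ∈ S, G q.2 (k + 1) := by
            refine Finset.sum_congr rfl fun q hq => ?_
            obtain ⟨b, hb⟩ : ∃ b, q.2 = b + 1 := Nat.exists_eq_succ_of_ne_zero (h0 q hq)
            rw [hb, Nat.add_sub_cancel, hG2]
      calc ‖(A ^ (k + 1)) x - (A' ^ (k + 1)) x‖
          = ‖∑ z, ((A ^ k) (T z x) - (A' ^ k) (T' z x))‖ := by rw [hexp]
        _ ≤ ∑ z, ‖(A ^ k) (T z x) - (A' ^ k) (T' z x)‖ := norm_sum_le _ _
        _ ≤ ∑ z, 2 * ‖x‖ * (σ + τ z) := Finset.sum_le_sum fun z _ => claim z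
        _ = 2 * ‖x‖ * (n * σ + ∑ z, τ z) := by
          rw [← Finset.mul_sum, Finset.sum_add_distrib, Finset.sum_const, Finset.card_univ,
            nsmul_eq_mul, hn]
        _ ≤ 2 * ‖x‖ * ∑ q ∈ S, G q.2 (k + 1) := by gcongr


/-- **Stub S6 of line `knabe-block-sampler`** (abstract light cone for block-resampling semigroups): comparing the
full generator with its restriction to `Λ ⊇ nbhd^{D}(R₀)` on a vector located in `R₀` costs
`2‖f‖ · #R₀ · (K t)^{D+1} / (D+1)!`. -/
theorem stub_lightCone : ∀ (E : Type) [NormedAddCommGroup E] [NormedSpace ℝ E] [CompleteSpace E] (ι : Type) [Fintype ι] [DecidableEq ι] (adj : ι → ι → Prop) [DecidableRel adj] (K : ℕ) (T : ι → E →L[ℝ] E) (M : Finset ι → Submodule ℝ E), (∀ z, adj z z) → (∀ w, (Finset.univ.filter fun z => adj z w).card ≤ K) → (∀ z, ‖T z‖ ≤ 1) → (∀ R R' : Finset ι, R ⊆ R' → M R ≤ M R') → (∀ (z : ι) (R : Finset ι), ∀ x ∈ M R, T z x ∈ M (insert z R)) → (∀ (z : ι) (R : Finset ι), (∀ w ∈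 R, ¬ adj z w) → ∀ x ∈ M R, T z x = x) → ∀ (R₀ Λ : Finset ι) (D : ℕ) (f : E), f ∈ M R₀ → (fun R : Finset ι => Finset.univ.filter fun z => ∃ w ∈ R, adj z w)^[D] R₀ ⊆ Λ → ∀ t : ℝ, 0 ≤ t → ‖NormedSpace.exp (-(t • ∑ z : ι, (1 - T z))) f - NormedSpace.exp (-(t • ∑ z ∈ Λ, (1 - T z))) f‖ ≤ 2 * ‖f‖ * R₀.card * (K * t) ^ (D + 1) / (D + 1).factorial := by
  intro E _ _ _ ι _ _ adj _ K T M hrefl hcol hT hmono hA2 hA3 R₀ Λ D f hf hΛ t ht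
  -- the neighbourhood map and its basic properties
  set N : Finset ι → Finset ι := fun R => Finset.univ.filter fun z => ∃ w ∈ R, adj z w with hN
  have hNadj : ∀ (R : Finset ι) (z w : ι), w ∈ R → adj z w → z ∈ N R := by
    intro R z w hw hzw
    simp only [hN, Finset.mem_filter, Finset.mem_univ, true_and]
    exact ⟨w, hw, hzw⟩
  have hNmono : Monotone N := by
    intro R R' hRR' z hz
    simp only [hN, Finset.mem_filter, Finset.mem_univ, true_and] at hz ⊢
    obtain ⟨w, hw, hzw⟩ := hz
    exact ⟨w, hRR' hw, hzw⟩
  have hNinfl : id ≤ N := fun R z hz => hNadj R z z hz (hrefl z)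
  -- the modified family: letters outside `Λ` replaced by the identity
  set T' : ι → E →L[ℝ] E := fun z => if z ∈ Λ then T z else 1 with hT'eq
  have hT'in : ∀ z ∈ Λ, T' z = T z := fun z hz => by simp [hT'eq, hz]
  have hT'out : ∀ z ∉ Λ, ∀ x, T' z x = x := fun z hz x => by simp [hT'eq, hz]
  have hT'norm : ∀ z, ‖T' z‖ ≤ 1 := by
    intro z
    by_cases hz : z ∈ Λ
    · rw [hT'in z hz]
      exact hT z
    · simp only [hT'eq, hz, if_false]
      exact ContinuousLinearMap.norm_id_le
  set n : ℝ := (Fintype.card ι : ℝ) with hn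
  set A : E →L[ℝ] E := ∑ z, T z with hA
  set A' : E →L[ℝ] E := ∑ z, T' z with hA'
  have hAn : ‖A‖ ≤ n := lightCone_norm_sum_le T hT
  have hA'n : ‖A'‖ ≤ n := lightCone_norm_sum_le T' hT'norm
  -- column bound in summed form
  have hcol' : ∀ (w : ι) (g : ℝ), 0 ≤ g → ∑ z, (if adj z w then g else 0) ≤ K * g := by
    intro w g hg
    rw [← Finset.sum_filter, Finset.sum_const, nsmul_eq_mul]
    exact mul_le_mul_of_nonneg_right (by exact_mod_cast hcol w) hg
  -- the weights `G β k = K^β C(k, β) n^(k-β)`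
  set G : ℕ → ℕ → ℝ := fun β k => (K : ℝ) ^ β * (k.choose β : ℝ) * n ^ (k - β) with hG
  have hG0 : ∀ β k, 0 ≤ G β k := fun β k => by positivity
  have hG1 : ∀ k, G 0 k = n ^ k := fun k => by simp [hG]
  have hG2 : ∀ b k, n * G (b + 1) k + K * G b k = G (b + 1) (k + 1) := fun b k =>
    lightCone_pascal n K k b
  -- the initial state: every site of `R₀` with depth budget `D + 1`
  set S₀ : Finset (ι × ℕ) := R₀ ×ˢ {D + 1} with hS₀
  have hS₀inv : ∀ p ∈ S₀, ∀ j < p.2, N^[j] {p.1} ⊆ Λ := by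
    intro p hp j hj
    rw [hS₀, Finset.mem_product, Finset.mem_singleton] at hp
    obtain ⟨hp1, hp2⟩ := hp
    rw [hp2] at hj
    calc N^[j] {p.1} ⊆ N^[j] R₀ := hNmono.iterate j (Finset.singleton_subset_iff.mpr hp1)
      _ ⊆ N^[D] R₀ := Function.monotone_iterate_of_id_le hNinfl (Nat.lt_succ_iff.mp hj) R₀
      _ ⊆ Λ := hΛ
  have hfS₀ : f ∈ M (S₀.image Prod.fst) := by
    refine hmono R₀ _ (fun y hy => ?_) hf
    exact Finset.mem_image.mpr
      ⟨(y, D + 1), Finset.mem_product.mpr ⟨hy, Finset.mem_singleton_self _⟩, rfl⟩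
  have hsumS₀ : ∀ k, ∑ p ∈ S₀, G p.2 k = R₀.card * G (D + 1) k := by
    intro k
    rw [hS₀, Finset.sum_product]
    simp
  -- the bound on Taylor coefficients
  have hk : ∀ k, ‖(A ^ k) f - (A' ^ k) f‖ ≤ 2 * ‖f‖ * (R₀.card * G (D + 1) k) := by
    intro k
    have := lightCone_main adj K n T T' M N Λ G hcol' hn.symm hAn hA'n hT hT'in hT'out hA2 hA3
      hNmono hNadj hG0 hG1 hG2 k S₀ hS₀inv f hfS₀
    rwa [hsumS₀ k] at this
  -- normalisation of both semigroups
  have e1 : NormedSpace.exp (-(t • ∑ z : ι, (1 - T z))) =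
      Real.exp (-(t * n)) • NormedSpace.exp (t • A) := lightCone_exp_shift T t
  have e2 : NormedSpace.exp (-(t • ∑ z ∈ Λ, (1 - T z))) =
      Real.exp (-(t * n)) • NormedSpace.exp (t • A') := by
    have hsum : ∑ z ∈ Λ, (1 - T z) = ∑ z, (1 - T' z) := by
      calc ∑ z ∈ Λ, (1 - T z) = ∑ z ∈ Finset.univ ∩ Λ, (1 - T z) := by rw [Finset.univ_inter]
        _ = ∑ z, (if z ∈ Λ then (1 - T z) else 0) := (Finset.sum_ite_mem _ _ _).symm
        _ = ∑ z, (1 - T' z) :=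
          Finset.sum_congr rfl fun z _ => by by_cases hz : z ∈ Λ <;> simp [hT'eq, hz]
    rw [hsum]
    exact lightCone_exp_shift T' t
  -- the two Taylor series, evaluated at `f`
  have hF : HasSum (fun k : ℕ => ((k.factorial : ℝ)⁻¹ • (t • A) ^ k) f -
      ((k.factorial : ℝ)⁻¹ • (t • A') ^ k) f)
      (NormedSpace.exp (t • A) f - NormedSpace.exp (t • A') f) := by
    have h1 := (ContinuousLinearMap.apply ℝ E f).hasSum
      (NormedSpace.exp_series_hasSum_exp' (𝕂 := ℝ) (t • A))
    have h2 := (ContinuousLinearMap.apply ℝ E f).hasSum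
      (NormedSpace.exp_series_hasSum_exp' (𝕂 := ℝ) (t • A'))
    simp only [ContinuousLinearMap.apply_apply] at h1 h2
    exact h1.sub h2
  have hGsum : HasSum (fun k : ℕ => (k.factorial : ℝ)⁻¹ * t ^ k *
      (2 * ‖f‖ * (R₀.card * (K : ℝ) ^ (D + 1)) * (k.choose (D + 1) : ℝ) * n ^ (k - (D + 1))))
      (2 * ‖f‖ * (R₀.card * (K : ℝ) ^ (D + 1)) * t ^ (D + 1) / (D + 1).factorial *
        Real.exp (t * n)) :=
    lightCone_hasSum_tail t n (2 * ‖f‖ * (R₀.card * (K : ℝ) ^ (D + 1))) (D + 1)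
  have hbound : ∀ k : ℕ, ‖((k.factorial : ℝ)⁻¹ • (t • A) ^ k) f -
      ((k.factorial : ℝ)⁻¹ • (t • A') ^ k) f‖ ≤ (k.factorial : ℝ)⁻¹ * t ^ k *
      (2 * ‖f‖ * (R₀.card * (K : ℝ) ^ (D + 1)) * (k.choose (D + 1) : ℝ) * n ^ (k - (D + 1))) := by
    intro k
    calc ‖((k.factorial : ℝ)⁻¹ • (t • A) ^ k) f - ((k.factorial : ℝ)⁻¹ • (t • A') ^ k) f‖
        = (k.factorial : ℝ)⁻¹ * (t ^ k * ‖(A ^ k) f - (A' ^ k) f‖) := by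
          rw [smul_pow, smul_pow, smul_apply, smul_apply, smul_apply, smul_apply, ← smul_sub,
            ← smul_sub, norm_smul, norm_smul, norm_inv, Real.norm_natCast,
            Real.norm_of_nonneg (pow_nonneg ht k)]
      _ ≤ (k.factorial : ℝ)⁻¹ * (t ^ k * (2 * ‖f‖ * (R₀.card * G (D + 1) k))) := by
          gcongr
          exact hk k
      _ = _ := by
          simp only [hG]
          ring
  have hnorm : ‖NormedSpace.exp (t • A) f - NormedSpace.exp (t • A') f‖ ≤
      2 * ‖f‖ * (R₀.card * (K : ℝ) ^ (D + 1)) * t ^ (D + 1) / (D + 1).factorial *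
        Real.exp (t * n) :=
    hF.norm_le_of_bounded hGsum hbound
  -- conclusion
  rw [e1, e2, smul_apply, smul_apply, ← smul_sub, norm_smul,
    Real.norm_of_nonneg (Real.exp_pos _).le]
  calc Real.exp (-(t * n)) * ‖NormedSpace.exp (t • A) f - NormedSpace.exp (t • A') f‖
      ≤ Real.exp (-(t * n)) * (2 * ‖f‖ * (R₀.card * (K : ℝ) ^ (D + 1)) * t ^ (D + 1) /
          (D + 1).factorial * Real.exp (t * n)) := by gcongr
    _ = 2 * ‖f‖ * (R₀.card * (K : ℝ) ^ (D + 1)) * t ^ (D + 1) / (D + 1).factorial *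
          (Real.exp (-(t * n)) * Real.exp (t * n)) := by ring
    _ = 2 * ‖f‖ * R₀.card * (K * t) ^ (D + 1) / (D + 1).factorial := by
          rw [← Real.exp_add, neg_add_cancel, Real.exp_zero, mul_one, mul_pow]
          ring

end Summit.QuantumFields.YangMills.Theorems.LatticeGapInUVUnits.KnabeBlockSampler

end
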